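import Literature.Analysis.FluidPDE.ConeCarlemanWeight
import Literature.Analysis.FluidPDE.BackwardUniquenessCutoffSecondEta
import HarnessLib

/-!
# The level-set cut-off for the cone Carleman inequality (Li–Šverák 2012, proof of Lemma 2.4)

Analysis/FluidPDE support file (theorems only; no definitions, no named facts) for the proof of
Li–Šverák's backward-uniqueness theorem in cones
(`Literature.Analysis.FluidPDE.coneBackwardUniquenessC12`). In the proof of Lemma 2.4 of the
paper the second Carleman inequality (Prop. 2.3, weight `φ = aΛ(s)φ₀(y) + s²`) is applied to
`w = ηv` with the cut-off `η = ψ₁(y₁)ψ₂(φ_B/B)` (times a cut-off `ξ` at infinity), where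
`ψ₂(φ_B/B)` cuts off along the level sets of the weight. Here, for the tree's form of the weight
(`ConeCarlemanWeight`: `φ = s² + a k₁(s)φ₀(y)`, `k₁(s) = (1-s)/s`,
`φ₀(y) = ⟪y,e⟫^{2β} - η(‖y‖²)^β`), we construct the analogous cut-off
`χ(s, y) = χ_t(s) · ψ(k₁(s)φ₀(y)) · Ψ(⟪y, e⟫)`: `ψ` the smooth step from `B/4` to `B/2` (the
level-set factor), `χ_t` a cut-off of the initial layer `[1/2 + θ, 1/2 + 2θ]` (replacing the
source's extension of `v` by zero to `s < 1/2`) and of a thin layer below `s = 1` (on which the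
level-set factor already vanishes), and `Ψ` the tree's cut-off in `⟪y, e⟫` (`exists_yn_cutoff`:
it localises to `⟪y,e⟫ > 1/2`, where `φ₀` is smooth, and cuts off at `⟪y, e⟫ ≥ R'' + 1`, which
in the cone `{ε‖y‖ < ⟪y,e⟫}` containing the support bounds `‖y‖`). We prove the derivative
bounds `((∂ₛ + Δ)χ)² ≤ C(θ⁻²𝟙_L + (1 + ‖y‖²)²(𝟙_M + 𝟙_N))`, `|∇χ|² ≤ C(1 + ‖y‖²)²(𝟙_M + 𝟙_N)`
on the transition regions (`L` the initial layer, `M = {k₁φ₀ ∈ [B/4, B/2]}` the level-set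
transition — the set `ω` of the paper, (2.18) —, `N = {⟪y,e⟫ ∈ [R'', R''+1]}`), cf. (2.18):
"`(|∂ₛη| + |∇η| + |Δη|)² < c₅|y|^{2α}` in the set `ω`".

* `cone_level_eq`, `contDiffOn_coneLevel`, `cone_level_derivs` — the level function
  `k₁(s)φ₀(y)` and its `∂ₛ`, `|∇|²`, `Δ`;
* `cone_level_bounds` — `|∂ₛ(k₁φ₀)|, |∇(k₁φ₀)|² ≤ 16(1 + ‖y‖²)`, `|Δ(k₁φ₀)| ≤ 2d + 6` for
  `1/2 ≤ s ≤ 1`, `⟪y, e⟫ ≥ 1`;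
* `facts_of_coneLevel_gt` — consequences of `k₁(s)φ₀(y) > B/4`;
* `exists_cone_levelset_cutoff` — the factor `ψ(k₁φ₀)`;
* `exists_cone_time_cutoff` — the factor `χ_t`;
* `exists_cone_cutoff` — the assembled cut-off and its bounds.

## References

* [LiSverak2012] Lu Li, V. Šverák, *Backward uniqueness for the heat equation in cones*,
  Comm. PDE 37 (2012), 1414–1429, arXiv:1011.2796 — proof of Lemma 2.4, (2.14)–(2.18).
* [Seregin2014] G. Seregin, *Lecture notes on regularity theory for the Navier–Stokes
  equations*, World Scientific 2014 — App. A.3, proof of Lemma A.3 (the template).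
-/

noncomputable section

open Set Function Filter Metric
open _root_.Topology
open scoped InnerProductSpace RealInnerProductSpace

namespace Literature.Analysis.FluidPDE

namespace Carleman

section ConeLevel

variable {E : Type*} [NormedAddCommGroup E] [InnerProductSpace ℝ E] [FiniteDimensional ℝ E]

/-! ### The level function `k₁(s) φ₀(y)` -/

omit [FiniteDimensional ℝ E] in
/-- `k₁(s)φ₀(y) = φ(s,y) - s²` with `φ` the cone Carleman weight at `a = 1`. [folklore] -/
theorem cone_level_eq (β η : ℝ) (e : E) :
    (fun z : ℝ × E => kA 1 z.1 * conePhi0 β η e z.2) =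
      fun z => conePhi 1 β η e z + (fun t : ℝ => -t ^ 2) z.1 := by
  funext z
  simp only [conePhi]
  ring

omit [FiniteDimensional ℝ E] in
/-- The level function is smooth on `Ω = {s > 0} × {⟪y, e⟫ > 0}`. [folklore] -/
theorem contDiffOn_coneLevel (β η : ℝ) (e : E) :
    ContDiffOn ℝ (⊤ : ℕ∞) (fun z : ℝ × E => kA 1 z.1 * conePhi0 β η e z.2) (halfDom e) := by
  rw [cone_level_eq]
  exact (contDiffOn_conePhi 1 β η e).add ((contDiff_id.pow 2).neg.comp contDiff_fst).contDiffOn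

omit [FiniteDimensional ℝ E] in
/-- `0 ≤ k₁(s) ≤ 1` and `|k₁'(s)| ≤ 4` for `1/2 ≤ s ≤ 1`. [folklore] -/
theorem kA_one_facts {s : ℝ} (hs : 1 / 2 ≤ s) (hs1 : s ≤ 1) :
    0 ≤ kA 1 s ∧ kA 1 s ≤ 1 ∧ |deriv (kA 1) s| ≤ 4 := by
  have hs0 : 0 < s := by linarith
  refine ⟨kA_one_nonneg hs0 hs1, ?_, ?_⟩
  · rw [kA_one_eq hs0, div_le_one hs0]; linarith
  · rw [deriv_kA_one hs0, abs_div, abs_neg, abs_one, abs_of_pos (by positivity : (0 : ℝ) < s ^ 2),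
      div_le_iff₀ (by positivity : (0 : ℝ) < s ^ 2)]
    nlinarith

omit [FiniteDimensional ℝ E] in
/-- `k₁(s) ≤ 2(1 - s)` for `1/2 ≤ s ≤ 1`. [folklore] -/
theorem kA_one_le_two_mul {s : ℝ} (hs : 1 / 2 ≤ s) (hs1 : s ≤ 1) : kA 1 s ≤ 2 * (1 - s) := by
  have hs0 : 0 < s := by linarith
  rw [kA_one_eq hs0, div_le_iff₀ hs0]
  nlinarith [mul_nonneg (by linarith : (0 : ℝ) ≤ 1 - s) (by linarith : (0 : ℝ) ≤ 2 * s - 1)]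

/-- **Derivatives of the level function** on `Ω`: `∂ₛ(k₁φ₀) = k₁'(s)φ₀(y)`,
`|∇(k₁φ₀)|² = k₁(s)²|∇φ₀(y)|²`, `Δ(k₁φ₀) = k₁(s)Δφ₀(y)` with
`Δφ₀ = 2β(2β-1)⟪y,e⟫^{2β-2} - η·2β(d+2β-2)(‖y‖²)^{β-1}`. [cite: LiSverak2012, §4] -/
theorem cone_level_derivs (β η : ℝ) {e : E} (he : ‖e‖ = 1) {z : ℝ × E} (hz : z ∈ halfDom e) :
    dt (fun z : ℝ × E => kA 1 z.1 * conePhi0 β η e z.2) z = deriv (kA 1) z.1 * conePhi0 β η e z.2 ∧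
    gradSq (fun z : ℝ × E => kA 1 z.1 * conePhi0 β η e z.2) z =
      kA 1 z.1 ^ 2 * ‖coneGrad β η e z.2‖ ^ 2 ∧
    lap (fun z : ℝ × E => kA 1 z.1 * conePhi0 β η e z.2) z =
      kA 1 z.1 * (2 * β * (2 * β - 1) * ⟪z.2, e⟫ ^ (2 * β - 2) -
        η * (2 * β * ((Module.finrank ℝ E : ℝ) + 2 * β - 2) * (‖z.2‖ ^ 2) ^ (β - 1))) := by
  have hΩo : IsOpen (halfDom e) := isOpen_halfDom e
  have hτ : ContDiff ℝ (⊤ : ℕ∞) (fun t : ℝ => -t ^ 2) := (contDiff_id.pow 2).neg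
  have hτ1 : ContDiff ℝ 1 (fun t : ℝ => -t ^ 2) := hτ.of_le (by norm_cast)
  have hA : DifferentiableAt ℝ (conePhi 1 β η e) z :=
    ((contDiffOn_conePhi 1 β η e).differentiableOn (by simp)).differentiableAt (hΩo.mem_nhds hz)
  have hB : DifferentiableAt ℝ (fun y : ℝ × E => (fun t : ℝ => -t ^ 2) y.1) z :=
    ((hτ.comp contDiff_fst).differentiable (by simp)).differentiableAt
  have hadd : fderiv ℝ (fun y : ℝ × E => conePhi 1 β η e y + (fun t : ℝ => -t ^ 2) y.1) z =
      fderiv ℝ (conePhi 1 β η e) z + fderiv ℝ (fun y : ℝ × E => (fun t : ℝ => -t ^ 2) y.1) z :=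
    fderiv_fun_add hA hB
  rw [cone_level_eq]
  refine ⟨?_, ?_, ?_⟩
  · -- `∂ₛ`
    have h1 : dt (fun y : ℝ × E => conePhi 1 β η e y + (fun t : ℝ => -t ^ 2) y.1) z =
        dt (conePhi 1 β η e) z + dt (fun y : ℝ × E => (fun t : ℝ => -t ^ 2) y.1) z := by
      rw [dt_apply, dt_apply, dt_apply, hadd]; rfl
    rw [h1, dt_conePhi 1 β η e hz, dt_timeProfile hτ1]
    have hd : deriv (fun t : ℝ => -t ^ 2) z.1 = -(2 * z.1) := by simp
    rw [hd]; ring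
  · -- `|∇|²`
    have h1 : ∀ u : E, dx u (fun y : ℝ × E => conePhi 1 β η e y + (fun t : ℝ => -t ^ 2) y.1) z =
        dx u (conePhi 1 β η e) z := by
      intro u
      rw [dx_apply, dx_apply, hadd]
      show fderiv ℝ (conePhi 1 β η e) z (0, u) +
        fderiv ℝ (fun y : ℝ × E => (fun t : ℝ => -t ^ 2) y.1) z (0, u) = _
      rw [← dx_apply, ← dx_apply, dx_timeProfile hτ1, add_zero]
    simp only [gradSq, h1]
    rw [← gradSq, ← norm_gradX_sq, norm_gradX_conePhi_sq 1 β η e hz, one_mul]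
  · -- `Δ`
    have hBc : ContDiffOn ℝ (⊤ : ℕ∞) (fun y : ℝ × E => (fun t : ℝ => -t ^ 2) y.1) (halfDom e) :=
      (hτ.comp contDiff_fst).contDiffOn
    rw [lap_add_of_contDiffOn hΩo (contDiffOn_conePhi 1 β η e) hBc hz,
      lap_timeProfile hτ1, add_zero, lap_conePhi 1 β η he hz, one_mul]

omit [FiniteDimensional ℝ E] in
/-- **Elementary bounds for `φ₀` and `∇φ₀`** at `y` with `⟪y, e⟫ ≥ 1` (`‖e‖ = 1`,
`1/2 < β ≤ 1`, `0 ≤ η ≤ 1`): `|φ₀(y)| ≤ 2‖y‖²`, `|∇φ₀(y)|² ≤ 16‖y‖²`, `1 ≤ ‖y‖²`,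
`⟪y,e⟫^{2β-2} ≤ 1`, `(‖y‖²)^{β-1} ≤ 1`. [folklore] -/
theorem conePhi0_bounds {β η : ℝ} (hβ : 1 / 2 < β) (hβ1 : β ≤ 1) (hη0 : 0 ≤ η) (hη1 : η ≤ 1)
    {e : E} (he : ‖e‖ = 1) {y : E} (hy : 1 ≤ ⟪y, e⟫) :
    |conePhi0 β η e y| ≤ 2 * ‖y‖ ^ 2 ∧ ‖coneGrad β η e y‖ ^ 2 ≤ 16 * ‖y‖ ^ 2 ∧ 1 ≤ ‖y‖ ^ 2 ∧
      ⟪y, e⟫ ^ (2 * β - 2) ≤ 1 ∧ (‖y‖ ^ 2) ^ (β - 1) ≤ 1 ∧ ⟪y, e⟫ ^ (2 * β) ≤ ‖y‖ ^ 2 := by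
  set r : ℝ := ⟪y, e⟫ with hr
  set N : ℝ := ‖y‖ ^ 2 with hN
  have hr1 : 1 ≤ r := hy
  have hr0 : 0 ≤ r := by linarith
  have hry : r ≤ ‖y‖ := by
    have := real_inner_le_norm y e; rwa [he, mul_one] at this
  have hy1 : 1 ≤ ‖y‖ := hr1.trans hry
  have hN1 : 1 ≤ N := by rw [hN]; nlinarith
  have hrN : r ^ 2 ≤ N := by rw [hN]; exact pow_le_pow_left₀ hr0 hry 2
  -- the powers
  have p1 : r ^ (2 * β) ≤ r ^ 2 := by
    rw [← Real.rpow_two]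
    exact Real.rpow_le_rpow_of_exponent_le hr1 (by linarith)
  have p2 : N ^ β ≤ N := by
    conv_rhs => rw [← Real.rpow_one N]
    exact Real.rpow_le_rpow_of_exponent_le hN1 hβ1
  have p3 : r ^ (2 * β - 2) ≤ 1 := Real.rpow_le_one_of_one_le_of_nonpos hr1 (by linarith)
  have p4 : N ^ (β - 1) ≤ 1 := Real.rpow_le_one_of_one_le_of_nonpos hN1 (by linarith)
  have p5 : r ^ (2 * β - 1) ≤ r := by
    conv_rhs => rw [← Real.rpow_one r]
    exact Real.rpow_le_rpow_of_exponent_le hr1 (by linarith)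
  have p50 : 0 ≤ r ^ (2 * β - 1) := Real.rpow_nonneg hr0 _
  have p40 : 0 ≤ N ^ (β - 1) := Real.rpow_nonneg (by positivity) _
  have p10 : 0 ≤ r ^ (2 * β) := Real.rpow_nonneg hr0 _
  have p20 : 0 ≤ N ^ β := Real.rpow_nonneg (by positivity) _
  refine ⟨?_, ?_, hN1, p3, p4, p1.trans hrN⟩
  · -- `|φ₀| ≤ r^{2β} + η N^β ≤ 2N`
    rw [conePhi0]
    refine (abs_sub _ _).trans ?_
    rw [abs_of_nonneg p10, abs_of_nonneg (mul_nonneg hη0 p20)]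
    have : η * N ^ β ≤ 1 * N := mul_le_mul hη1 p2 p20 zero_le_one
    linarith
  · -- `|∇φ₀|² ≤ 2a² + 2b²N ≤ 16N`, `a = 2βr^{2β-1} ≤ 2r`, `b = 2βηN^{β-1} ≤ 2`
    rw [norm_coneGrad_sq β η he y]
    set a : ℝ := 2 * β * r ^ (2 * β - 1) with ha
    set b : ℝ := 2 * β * η * N ^ (β - 1) with hb
    have ha0 : 0 ≤ a := by positivity
    have hb0 : 0 ≤ b := by positivity
    have ha1 : a ≤ 2 * ‖y‖ := by
      rw [ha]
      have : β * r ^ (2 * β - 1) ≤ 1 * ‖y‖ := mul_le_mul hβ1 (p5.trans hry) p50 zero_le_one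
      linarith
    have hb1 : b ≤ 2 := by
      rw [hb]
      have h1 : β * η ≤ 1 := by nlinarith
      have : β * η * N ^ (β - 1) ≤ 1 * 1 := mul_le_mul h1 p4 p40 zero_le_one
      linarith
    have hcross : -(2 * a * b * r) ≤ a ^ 2 + b ^ 2 * r ^ 2 := by nlinarith [sq_nonneg (a + b * r)]
    have h1 : a ^ 2 ≤ 4 * N := by
      have := pow_le_pow_left₀ ha0 ha1 2; rw [hN]; nlinarith
    have h2 : b ^ 2 ≤ 4 := by nlinarith
    have h3 : b ^ 2 * N ≤ 4 * N := by nlinarith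
    have h4 : b ^ 2 * r ^ 2 ≤ b ^ 2 * N := mul_le_mul_of_nonneg_left hrN (sq_nonneg _)
    rw [← hN]
    nlinarith

/-- **Bounds for the derivatives of the level function** at `z = (s, y) ∈ Ω` with
`1/2 ≤ s ≤ 1`, `⟪y, e⟫ ≥ 1` (`1/2 < β ≤ 1`, `0 ≤ η ≤ 1`): `|∂ₛ(k₁φ₀)| ≤ 16(1 + ‖y‖²)`,
`|∇(k₁φ₀)|² ≤ 16(1 + ‖y‖²)`, `|Δ(k₁φ₀)| ≤ 2d + 6`. [folklore] -/
theorem cone_level_bounds {β η : ℝ} (hβ : 1 / 2 < β) (hβ1 : β ≤ 1) (hη0 : 0 ≤ η) (hη1 : η ≤ 1)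
    {e : E} (he : ‖e‖ = 1) {z : ℝ × E} (hs : 1 / 2 ≤ z.1) (hs1 : z.1 ≤ 1) (hy : 1 ≤ ⟪z.2, e⟫) :
    |dt (fun z : ℝ × E => kA 1 z.1 * conePhi0 β η e z.2) z| ≤ 16 * (1 + ‖z.2‖ ^ 2) ∧
    gradSq (fun z : ℝ × E => kA 1 z.1 * conePhi0 β η e z.2) z ≤ 16 * (1 + ‖z.2‖ ^ 2) ∧
    |lap (fun z : ℝ × E => kA 1 z.1 * conePhi0 β η e z.2) z| ≤
      2 * (Module.finrank ℝ E : ℝ) + 6 := by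
  have hz : z ∈ halfDom e := ⟨by linarith, by linarith⟩
  obtain ⟨hdt, hg, hlap⟩ := cone_level_derivs β η he hz
  obtain ⟨hk0, hk1, hk'⟩ := kA_one_facts hs hs1
  obtain ⟨hφ, hgrad, hN1, p3, p4, -⟩ := conePhi0_bounds hβ hβ1 hη0 hη1 he hy
  set N : ℝ := ‖z.2‖ ^ 2 with hN
  refine ⟨?_, ?_, ?_⟩
  · rw [hdt, abs_mul]
    calc |deriv (kA 1) z.1| * |conePhi0 β η e z.2| ≤ 4 * (2 * N) :=
          mul_le_mul hk' hφ (abs_nonneg _) (by norm_num)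
      _ ≤ 16 * (1 + N) := by nlinarith
  · rw [hg]
    have h1 : kA 1 z.1 ^ 2 ≤ 1 := by nlinarith
    calc kA 1 z.1 ^ 2 * ‖coneGrad β η e z.2‖ ^ 2 ≤ 1 * (16 * N) :=
          mul_le_mul h1 hgrad (sq_nonneg _) zero_le_one
      _ ≤ 16 * (1 + N) := by nlinarith
  · rw [hlap, abs_mul, abs_of_nonneg hk0]
    set d : ℝ := (Module.finrank ℝ E : ℝ) with hd
    have hd0 : 0 ≤ d := by rw [hd]; positivity
    have p30 : 0 ≤ ⟪z.2, e⟫ ^ (2 * β - 2) := Real.rpow_nonneg (by linarith) _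
    have p40 : 0 ≤ (‖z.2‖ ^ 2) ^ (β - 1) := Real.rpow_nonneg (by positivity) _
    have hT1 : |2 * β * (2 * β - 1) * ⟪z.2, e⟫ ^ (2 * β - 2)| ≤ 2 := by
      rw [abs_of_nonneg (by
        have : 0 ≤ 2 * β - 1 := by linarith
        positivity)]
      have h1 : 2 * β * (2 * β - 1) ≤ 2 := by nlinarith
      have h0 : 0 ≤ 2 * β * (2 * β - 1) := by nlinarith
      calc 2 * β * (2 * β - 1) * ⟪z.2, e⟫ ^ (2 * β - 2) ≤ 2 * 1 := mul_le_mul h1 p3 p30 (by norm_num)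
        _ = 2 := by norm_num
    have hT2 : |η * (2 * β * (d + 2 * β - 2) * (‖z.2‖ ^ 2) ^ (β - 1))| ≤ 2 * d + 4 := by
      rw [abs_mul, abs_of_nonneg hη0, abs_mul, abs_of_nonneg p40]
      have h1 : |2 * β * (d + 2 * β - 2)| ≤ 2 * d + 4 := by
        rw [abs_mul, abs_of_nonneg (by linarith : (0 : ℝ) ≤ 2 * β)]
        have h2 : |d + 2 * β - 2| ≤ d + 2 := by
          rw [abs_le]; constructor <;> linarith
        calc 2 * β * |d + 2 * β - 2| ≤ 2 * (d + 2) :=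
              mul_le_mul (by linarith) h2 (abs_nonneg _) (by norm_num)
          _ = 2 * d + 4 := by ring
      calc η * (|2 * β * (d + 2 * β - 2)| * (‖z.2‖ ^ 2) ^ (β - 1)) ≤ 1 * ((2 * d + 4) * 1) := by
            refine mul_le_mul hη1 (mul_le_mul h1 p4 p40 (by positivity)) (by positivity) zero_le_one
        _ = 2 * d + 4 := by ring
    calc kA 1 z.1 * |2 * β * (2 * β - 1) * ⟪z.2, e⟫ ^ (2 * β - 2) -
          η * (2 * β * (d + 2 * β - 2) * (‖z.2‖ ^ 2) ^ (β - 1))|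
        ≤ 1 * (2 + (2 * d + 4)) := by
          refine mul_le_mul hk1 ((abs_sub _ _).trans (add_le_add hT1 hT2)) (abs_nonneg _) zero_le_one
      _ = 2 * d + 6 := by ring

omit [FiniteDimensional ℝ E] in
/-- **`φ₀ > 0` means `y` lies in the cone**: for `⟪y, e⟫ > 0`, `0 < ε`, `η = ε^{2β}`, `β > 0`,
`0 < φ₀(y)` implies `ε‖y‖ < ⟪y, e⟫` (`η(‖y‖²)^β = ((ε‖y‖)²)^β`, `⟪y,e⟫^{2β} = (⟪y,e⟫²)^β`).
[folklore] -/
theorem cone_of_conePhi0_pos {β ε η : ℝ} (hβ : 0 < β) (hε : 0 < ε) (hηε : η = ε ^ (2 * β))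
    {e : E} {y : E} (hy : 0 < ⟪y, e⟫) (h : 0 < conePhi0 β η e y) : ε * ‖y‖ < ⟪y, e⟫ := by
  rw [conePhi0, sub_pos] at h
  have e1 : η * (‖y‖ ^ 2) ^ β = ((ε * ‖y‖) ^ 2) ^ β := by
    rw [hηε, mul_pow, Real.mul_rpow (by positivity) (by positivity), ← Real.rpow_natCast ε 2,
      ← Real.rpow_mul hε.le]
    push_cast
    ring_nf
  have e2 : ⟪y, e⟫ ^ (2 * β) = (⟪y, e⟫ ^ 2) ^ β := by
    rw [← Real.rpow_natCast ⟪y, e⟫ 2, ← Real.rpow_mul hy.le]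
    push_cast
    ring_nf
  rw [e1, e2, Real.rpow_lt_rpow_iff (by positivity) (by positivity) hβ] at h
  nlinarith [norm_nonneg y, hε]

omit [FiniteDimensional ℝ E] in
/-- **Consequences of `k₁(s)φ₀(y) > B/4`** (`B ≥ 16`, `1/2 ≤ s < 1`, `⟪y, e⟫ > 0`,
`1/2 < β ≤ 1`, `0 ≤ η`): `φ₀(y) > B/4`, `⟪y, e⟫ > 2`, and `1 - s > B/(8R²)` if `⟪y, e⟫ ≤ R`
(`R ≥ 1`). [folklore] -/
theorem facts_of_coneLevel_gt {β η B s R : ℝ} {e y : E} (hβ : 1 / 2 < β)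
    (hβ1 : β ≤ 1) (hη0 : 0 ≤ η) (hB : 16 ≤ B) (hs : 1 / 2 ≤ s) (hs1 : s < 1) (hy : 0 < ⟪y, e⟫)
    (hR : 1 ≤ R) (hyR : ⟪y, e⟫ ≤ R) (h : B / 4 < kA 1 s * conePhi0 β η e y) :
    B / 4 < conePhi0 β η e y ∧ 2 < ⟪y, e⟫ ∧ s < 1 - B / (8 * R ^ 2) := by
  obtain ⟨hk0, hk1, -⟩ := kA_one_facts hs hs1.le
  set r : ℝ := ⟪y, e⟫ with hr
  set φ : ℝ := conePhi0 β η e y with hφ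
  -- `φ₀ > B/4`
  have hφ0 : 0 < φ := by
    by_contra hc
    push Not at hc
    have : kA 1 s * φ ≤ 0 := mul_nonpos_of_nonneg_of_nonpos hk0 hc
    linarith
  have hφB : B / 4 < φ := by
    have : kA 1 s * φ ≤ 1 * φ := mul_le_mul_of_nonneg_right hk1 hφ0.le
    linarith
  -- `φ₀ ≤ r^{2β}` and `r > 2`
  have hφr : φ ≤ r ^ (2 * β) := by
    rw [hφ, conePhi0]
    have : 0 ≤ η * (‖y‖ ^ 2) ^ β := mul_nonneg hη0 (Real.rpow_nonneg (by positivity) _)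
    linarith
  have hr2 : 2 < r := by
    by_contra hc
    push Not at hc
    have h1 : r ^ (2 * β) ≤ (2 : ℝ) ^ (2 * β) := Real.rpow_le_rpow hy.le hc (by linarith)
    have h2 : (2 : ℝ) ^ (2 * β) ≤ (2 : ℝ) ^ (2 : ℝ) :=
      Real.rpow_le_rpow_of_exponent_le (by norm_num) (by linarith)
    rw [Real.rpow_two] at h2
    linarith
  refine ⟨hφB, hr2, ?_⟩
  -- `1 - s > B/(8R²)`: `k₁ ≤ 2(1-s)`, `φ₀ ≤ r² ≤ R²`
  have hr1 : 1 ≤ r := by linarith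
  have hφR : φ ≤ R ^ 2 := by
    have h1 : r ^ (2 * β) ≤ r ^ 2 := by
      rw [← Real.rpow_two]; exact Real.rpow_le_rpow_of_exponent_le hr1 (by linarith)
    have h2 : r ^ 2 ≤ R ^ 2 := pow_le_pow_left₀ (by linarith) hyR 2
    linarith
  have hk2 : kA 1 s ≤ 2 * (1 - s) := kA_one_le_two_mul hs hs1.le
  have h1 : kA 1 s * φ ≤ 2 * (1 - s) * R ^ 2 := mul_le_mul hk2 hφR hφ0.le (by linarith)
  have h2 : B / 4 < 2 * (1 - s) * R ^ 2 := lt_of_lt_of_le h h1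
  have hR2 : 0 < R ^ 2 := by positivity
  rw [lt_sub_iff_add_lt, ← lt_sub_iff_add_lt', div_lt_iff₀ (by positivity)]
  nlinarith


/-! ### The level-set cut-off `ψ(k₁(s)φ₀(y))` -/

/-- **The level-set factor of the cut-off** (Li–Šverák 2012, proof of Lemma 2.4: the factor
`ψ₂(φ_B/B)`). There is `C = C(dim E) ≥ 0` such that for every unit vector `e`, `1/2 < β ≤ 1`,
`0 ≤ η ≤ 1` and `B ≥ 16` there is `m : ℝ × E → ℝ` (`m = ψ(k₁(s)φ₀(y))`, `ψ` the smooth step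
from `B/4` to `B/2`), smooth on `Ω = {s > 0} × {⟪y,e⟫ > 0}`, with values in `[0, 1]`, `= 0`
where `k₁φ₀ ≤ B/4`, `= 1` where `k₁φ₀ ≥ B/2`, `∂ₛm = ∇m = Δm = 0` at points of `Ω` where
`k₁φ₀ ∉ [B/4, B/2]`, and `|∂ₛm|, |∇m|², |Δm| ≤ C(1 + ‖y‖²)` at points with `1/2 ≤ s ≤ 1`,
`⟪y, e⟫ ≥ 1`. [cite: LiSverak2012, proof of Lemma 2.4, (2.18)] -/
theorem exists_cone_levelset_cutoff : ∃ C : ℝ, 0 ≤ C ∧ ∀ (e : E), ‖e‖ = 1 →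
    ∀ (β η B : ℝ), 1 / 2 < β → β ≤ 1 → 0 ≤ η → η ≤ 1 → 16 ≤ B →
    ∃ m : ℝ × E → ℝ,
      ContDiffOn ℝ (⊤ : ℕ∞) m (halfDom e) ∧
      (∀ z, 0 ≤ m z) ∧ (∀ z, m z ≤ 1) ∧
      (∀ z : ℝ × E, kA 1 z.1 * conePhi0 β η e z.2 ≤ B / 4 → m z = 0) ∧
      (∀ z : ℝ × E, B / 2 ≤ kA 1 z.1 * conePhi0 β η e z.2 → m z = 1) ∧
      (∀ z ∈ halfDom e, kA 1 z.1 * conePhi0 β η e z.2 ∉ Icc (B / 4) (B / 2) →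
        dt m z = 0 ∧ gradSq m z = 0 ∧ lap m z = 0) ∧
      (∀ z : ℝ × E, 1 / 2 ≤ z.1 → z.1 ≤ 1 → 1 ≤ ⟪z.2, e⟫ →
        |dt m z| ≤ C * (1 + ‖z.2‖ ^ 2) ∧ gradSq m z ≤ C * (1 + ‖z.2‖ ^ 2) ∧
          |lap m z| ≤ C * (1 + ‖z.2‖ ^ 2)) := by
  obtain ⟨D₁, D₂, hD₁, hD₂, hstep⟩ := exists_smooth_step
  set d : ℝ := (Module.finrank ℝ E : ℝ) with hd
  have hd0 : 0 ≤ d := by rw [hd]; positivity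
  refine ⟨4 * D₁ + D₁ ^ 2 + D₂ + D₁ * (2 * d + 6) + 1, by positivity, ?_⟩
  intro e he β η B hβ hβ1 hη0 hη1 hB
  have hB0 : 0 < B := by linarith
  obtain ⟨ψ, hψ, hψ0, hψ1, hψnn, hψle, hψ', hψ'', hψ'0, hψ''0⟩ := hstep (B / 4) (B / 2) (by linarith)
  rw [show B / 2 - B / 4 = B / 4 by ring] at hψ' hψ''
  -- the level function and the cut-off
  set L : ℝ × E → ℝ := fun z => kA 1 z.1 * conePhi0 β η e z.2 with hL
  set Ω : Set (ℝ × E) := halfDom e with hΩ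
  have hΩo : IsOpen Ω := isOpen_halfDom e
  have hLs : ContDiffOn ℝ (⊤ : ℕ∞) L Ω := contDiffOn_coneLevel β η e
  have hL2 : ContDiffOn ℝ 2 L Ω := hLs.of_le (by norm_cast)
  set m : ℝ × E → ℝ := fun z => ψ (L z) with hm
  have hms : ContDiffOn ℝ (⊤ : ℕ∞) m Ω := hψ.comp_contDiffOn hLs
  have hψd : Differentiable ℝ ψ := hψ.differentiable (by simp)
  have hψ2 : ContDiff ℝ 2 ψ := hψ.of_le (by norm_cast)
  have hLd : ∀ z ∈ Ω, DifferentiableAt ℝ L z := fun z hz =>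
    (hLs.differentiableOn (by simp)).differentiableAt (hΩo.mem_nhds hz)
  -- the derivative formulas at `z ∈ Ω`
  have hdtm : ∀ z ∈ Ω, dt m z = deriv ψ (L z) * dt L z := fun z hz =>
    dt_comp_scalar (hψd _) (hLd z hz)
  have hgm : ∀ z ∈ Ω, gradSq m z = deriv ψ (L z) ^ 2 * gradSq L z := fun z hz =>
    gradSq_comp_scalar (hψd _) (hLd z hz)
  have hlapm : ∀ z ∈ Ω, lap m z = deriv (deriv ψ) (L z) * gradSq L z + deriv ψ (L z) * lap L z :=
    fun z hz => lap_comp_scalar hΩo hz hψ2 hL2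
  refine ⟨m, hms, fun z => hψnn _, fun z => hψle _, fun z hz => hψ0 _ hz, fun z hz => hψ1 _ hz,
    ?_, ?_⟩
  · -- derivatives vanish off the transition set
    intro z hz hnot
    have hLout : L z < B / 4 ∨ B / 2 < L z := by
      simp only [mem_Icc, not_and_or, not_le] at hnot
      exact hnot
    have h1 : deriv ψ (L z) = 0 := hψ'0 _ hLout
    have h2 : deriv (deriv ψ) (L z) = 0 := hψ''0 _ hLout
    refine ⟨?_, ?_, ?_⟩
    · rw [hdtm z hz, h1, zero_mul]
    · rw [hgm z hz, h1]; ring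
    · rw [hlapm z hz, h1, h2]; ring
  · -- the bounds
    intro z hz1 hz2 hr
    have hz : z ∈ Ω := ⟨by linarith, by linarith⟩
    obtain ⟨hdtL, hgL, hlapL⟩ := cone_level_bounds hβ hβ1 hη0 hη1 he hz1 hz2 hr
    set N : ℝ := ‖z.2‖ ^ 2 with hN
    have hN0 : 0 ≤ N := by positivity
    have hψ'b : |deriv ψ (L z)| ≤ D₁ / 4 := by
      refine (hψ' _).trans ?_
      rw [div_le_div_iff₀ (by positivity) (by norm_num)]
      nlinarith
    have hψ''b : |deriv (deriv ψ) (L z)| ≤ D₂ / 16 := by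
      refine (hψ'' _).trans ?_
      rw [div_le_div_iff₀ (by positivity) (by norm_num)]
      have : (16 : ℝ) * 16 ≤ B ^ 2 := by nlinarith
      nlinarith
    have hgL0 := gradSq_nonneg L z
    set Ctot : ℝ := 4 * D₁ + D₁ ^ 2 + D₂ + D₁ * (2 * d + 6) + 1 with hCtot
    have e1 : gradSq L z = gradSq (fun z : ℝ × E => kA 1 z.1 * conePhi0 β η e z.2) z := rfl
    have e2 : dt L z = dt (fun z : ℝ × E => kA 1 z.1 * conePhi0 β η e z.2) z := rfl
    have e3 : lap L z = lap (fun z : ℝ × E => kA 1 z.1 * conePhi0 β η e z.2) z := rfl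
    rw [← e1] at hgL
    rw [← e2] at hdtL
    rw [← e3] at hlapL
    have hx1 : 0 ≤ D₁ ^ 2 := sq_nonneg _
    have hx2 : 0 ≤ D₁ * (2 * d + 6) := by positivity
    refine ⟨?_, ?_, ?_⟩
    · rw [hdtm z hz, abs_mul]
      calc |deriv ψ (L z)| * |dt L z| ≤ D₁ / 4 * (16 * (1 + N)) :=
            mul_le_mul hψ'b hdtL (abs_nonneg _) (by positivity)
        _ = 4 * D₁ * (1 + N) := by ring
        _ ≤ Ctot * (1 + N) := by
            refine mul_le_mul_of_nonneg_right ?_ (by positivity)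
            rw [hCtot]; linarith
    · rw [hgm z hz]
      have h1 : deriv ψ (L z) ^ 2 ≤ (D₁ / 4) ^ 2 := by
        rw [← sq_abs]; exact pow_le_pow_left₀ (abs_nonneg _) hψ'b 2
      calc deriv ψ (L z) ^ 2 * gradSq L z ≤ (D₁ / 4) ^ 2 * (16 * (1 + N)) :=
            mul_le_mul h1 hgL hgL0 (by positivity)
        _ = D₁ ^ 2 * (1 + N) := by ring
        _ ≤ Ctot * (1 + N) := by
            refine mul_le_mul_of_nonneg_right ?_ (by positivity)
            rw [hCtot]; linarith
    · rw [hlapm z hz]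
      calc |deriv (deriv ψ) (L z) * gradSq L z + deriv ψ (L z) * lap L z|
          ≤ |deriv (deriv ψ) (L z)| * gradSq L z + |deriv ψ (L z)| * |lap L z| := by
            refine (abs_add_le _ _).trans (add_le_add ?_ ?_)
            · rw [abs_mul, abs_of_nonneg hgL0]
            · rw [abs_mul]
        _ ≤ D₂ / 16 * (16 * (1 + N)) + D₁ / 4 * (2 * d + 6) :=
            add_le_add (mul_le_mul hψ''b hgL hgL0 (by positivity))
              (mul_le_mul hψ'b hlapL (abs_nonneg _) (by positivity))
        _ ≤ Ctot * (1 + N) := by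
            rw [hCtot]
            have h1 : D₁ / 4 * (2 * d + 6) ≤ D₁ * (2 * d + 6) * (1 + N) := by nlinarith
            nlinarith

/-! ### The time cut-off `χ_t` -/

omit [FiniteDimensional ℝ E] in
/-- **The time factor of the cut-off.** For `0 < θ` and `0 < δ` there is a smooth
`χ_t : ℝ → ℝ` with values in `[0, 1]`, `χ_t = 0` on `]-∞, 1/2 + θ]` and on `[1 - δ, ∞[`,
`χ_t = 1` on `[1/2 + 2θ, 1 - 2δ]`, and, at points `s < 1 - 2δ`, `|χ_t'(s)| ≤ D₁/θ` with
`χ_t'(s) = 0` unless `s ∈ [1/2 + θ, 1/2 + 2θ]` (`χ_t = χ_b(1 - χ_top)`, two smooth steps;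
`D₁` the constant of `exists_smooth_step`). [folklore] -/
theorem exists_cone_time_cutoff : ∃ D : ℝ, 0 ≤ D ∧ ∀ (θ δ : ℝ), 0 < θ → 0 < δ →
    ∃ χ : ℝ → ℝ, ContDiff ℝ (⊤ : ℕ∞) χ ∧ (∀ s, 0 ≤ χ s) ∧ (∀ s, χ s ≤ 1) ∧
      (∀ s, s ≤ 1 / 2 + θ → χ s = 0) ∧ (∀ s, 1 - δ ≤ s → χ s = 0) ∧
      (∀ s, 1 / 2 + 2 * θ ≤ s → s ≤ 1 - 2 * δ → χ s = 1) ∧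
      (∀ s, s < 1 - 2 * δ → |deriv χ s| ≤ D / θ) ∧
      (∀ s, s < 1 - 2 * δ → (s < 1 / 2 + θ ∨ 1 / 2 + 2 * θ < s) → deriv χ s = 0) := by
  obtain ⟨D₁, D₂, hD₁, hD₂, hstep⟩ := exists_smooth_step
  refine ⟨D₁, hD₁, fun θ δ hθ hδ => ?_⟩
  obtain ⟨χb, hχb, hχb0, hχb1, hχbnn, hχble, hχb', -, hχb'0, -⟩ :=
    hstep (1 / 2 + θ) (1 / 2 + 2 * θ) (by linarith)
  rw [show 1 / 2 + 2 * θ - (1 / 2 + θ) = θ by ring] at hχb'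
  obtain ⟨χu, hχu, hχu0, hχu1, hχunn, hχule, -, -, hχu'0, -⟩ :=
    hstep (1 - 2 * δ) (1 - δ) (by linarith)
  set χ : ℝ → ℝ := fun s => χb s * (1 - χu s) with hχ
  have hχs : ContDiff ℝ (⊤ : ℕ∞) χ := hχb.mul (contDiff_const.sub hχu)
  have hbd : Differentiable ℝ χb := hχb.differentiable (by simp)
  have hud : Differentiable ℝ χu := hχu.differentiable (by simp)
  have hderiv : ∀ s, deriv χ s = deriv χb s * (1 - χu s) + χb s * (-deriv χu s) := by
    intro s
    have h1 : HasDerivAt (fun s => 1 - χu s) (-deriv χu s) s := by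
      simpa using (hud s).hasDerivAt.const_sub 1
    exact ((hbd s).hasDerivAt.mul h1).deriv
  refine ⟨χ, hχs, fun s => mul_nonneg (hχbnn s) (by linarith [hχule s]), fun s => ?_, ?_, ?_, ?_,
    ?_, ?_⟩
  · calc χb s * (1 - χu s) ≤ 1 * 1 :=
        mul_le_mul (hχble s) (by linarith [hχunn s]) (by linarith [hχule s]) zero_le_one
      _ = 1 := one_mul _
  · intro s hs; simp only [hχ]; rw [hχb0 s hs, zero_mul]
  · intro s hs; simp only [hχ]; rw [hχu1 s hs]; ring
  · intro s hs1 hs2; simp only [hχ]; rw [hχb1 s hs1, hχu0 s hs2]; ring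
  · intro s hs
    rw [hderiv s, hχu0 s hs.le, hχu'0 s (Or.inl hs)]
    simp only [sub_zero, mul_one, neg_zero, mul_zero, add_zero]
    exact hχb' s
  · intro s hs hout
    rw [hderiv s, hχu0 s hs.le, hχu'0 s (Or.inl hs), hχb'0 s hout]
    simp


omit [FiniteDimensional ℝ E] in
/-- `φ₀(y) ≤ ⟪y, e⟫²` for `⟪y, e⟫ ≥ 1`, `β ≤ 1`, `η ≥ 0`. [folklore] -/
theorem conePhi0_le_inner_sq {β η : ℝ} (hβ1 : β ≤ 1) (hη0 : 0 ≤ η) {e y : E} (hy : 1 ≤ ⟪y, e⟫) :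
    conePhi0 β η e y ≤ ⟪y, e⟫ ^ 2 := by
  rw [conePhi0]
  have h1 : ⟪y, e⟫ ^ (2 * β) ≤ ⟪y, e⟫ ^ 2 := by
    rw [← Real.rpow_two]; exact Real.rpow_le_rpow_of_exponent_le hy (by linarith)
  have h2 : 0 ≤ η * (‖y‖ ^ 2) ^ β := mul_nonneg hη0 (Real.rpow_nonneg (by positivity) _)
  linarith

omit [FiniteDimensional ℝ E] in
/-- `φ₀` is continuous (`β > 0`). [folklore] -/
theorem continuous_conePhi0 {β : ℝ} (hβ : 0 < β) (η : ℝ) (e : E) :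
    Continuous fun y : E => conePhi0 β η e y := by
  unfold conePhi0
  exact ((continuous_id.inner continuous_const).rpow_const fun _ => Or.inr (by linarith)).sub
    (continuous_const.mul ((continuous_norm.pow 2).rpow_const fun _ => Or.inr hβ.le))

/-! ### The assembled cut-off -/

set_option maxHeartbeats 1600000 in
/-- **The cut-off for the cone Carleman inequality** (Li–Šverák 2012, proof of Lemma 2.4: the
function `η(y, s) = ψ₁(y₁)ψ₂(φ_B/B)`, times a cut-off of the initial layer and a cut-off at
infinity). There is `C = C(dim E) > 0` such that for every unit vector `e`, `1/2 < β ≤ 1`,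
`0 < ε ≤ 1`, `η = ε^{2β}`, `B ≥ 16`, `0 < θ ≤ 1/8`, `R'' ≥ 2`, there is `χ ∈ C²_c(ℝ × E)` with
`tsupport χ ⊆ [1/2 + θ, 1 - B/(32(R''+1)²)] × {ε‖y‖ < ⟪y,e⟫, 2 ≤ ⟪y,e⟫ ≤ R''+1, φ₀(y) ≥ B/4}`,
values in `[0, 1]`, `χ = 1` where `1/2 + 2θ ≤ s ≤ 1`, `1 ≤ ⟪y,e⟫ ≤ R''`, `k₁(s)φ₀(y) ≥ B/2`, and
`((∂ₛ + Δ)χ)² ≤ C(θ⁻² 𝟙_L + (1 + ‖y‖²)²(𝟙_M + 𝟙_N))`, `|∇χ|² ≤ C(1 + ‖y‖²)²(𝟙_M + 𝟙_N)`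
everywhere, where `L = {s ∈ [1/2+θ, 1/2+2θ]}`,
`M = {s > 0, ⟪y,e⟫ > 0, k₁(s)φ₀(y) ∈ [B/4, B/2]}` (the set `ω` of (2.18)),
`N = {⟪y,e⟫ ∈ [R'', R''+1]}`. [cite: LiSverak2012, proof of Lemma 2.4, (2.14)–(2.18)] -/
theorem exists_cone_cutoff : ∃ C : ℝ, 0 < C ∧ ∀ (e : E), ‖e‖ = 1 →
    ∀ (β ε η B θ R'' : ℝ), 1 / 2 < β → β ≤ 1 → 0 < ε → ε ≤ 1 → η = ε ^ (2 * β) →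
    16 ≤ B → 0 < θ → θ ≤ 1 / 8 → 2 ≤ R'' →
    ∃ χ : ℝ × E → ℝ, ContDiff ℝ 2 χ ∧ HasCompactSupport χ ∧
      tsupport χ ⊆ Icc (1 / 2 + θ) (1 - B / (32 * (R'' + 1) ^ 2)) ×ˢ
        {y : E | ε * ‖y‖ < ⟪y, e⟫ ∧ 2 ≤ ⟪y, e⟫ ∧ ⟪y, e⟫ ≤ R'' + 1 ∧ B / 4 ≤ conePhi0 β η e y} ∧
      (∀ z, 0 ≤ χ z) ∧ (∀ z, χ z ≤ 1) ∧
      (∀ z : ℝ × E, 1 / 2 + 2 * θ ≤ z.1 → z.1 ≤ 1 → 1 ≤ ⟪z.2, e⟫ → ⟪z.2, e⟫ ≤ R'' →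
        B / 2 ≤ kA 1 z.1 * conePhi0 β η e z.2 → χ z = 1) ∧
      (∀ z : ℝ × E, (dt χ z + lap χ z) ^ 2 ≤
        C * (θ⁻¹ ^ 2 * (Icc (1 / 2 + θ) (1 / 2 + 2 * θ)).indicator (fun _ => (1 : ℝ)) z.1 +
          (1 + ‖z.2‖ ^ 2) ^ 2 *
            ({z : ℝ × E | 0 < z.1 ∧ 0 < ⟪z.2, e⟫ ∧
                kA 1 z.1 * conePhi0 β η e z.2 ∈ Icc (B / 4) (B / 2)}.indicator
                (fun _ => (1 : ℝ)) z +
              (Icc R'' (R'' + 1)).indicator (fun _ => (1 : ℝ)) ⟪z.2, e⟫))) ∧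
      (∀ z : ℝ × E, gradSq χ z ≤
        C * ((1 + ‖z.2‖ ^ 2) ^ 2 *
            ({z : ℝ × E | 0 < z.1 ∧ 0 < ⟪z.2, e⟫ ∧
                kA 1 z.1 * conePhi0 β η e z.2 ∈ Icc (B / 4) (B / 2)}.indicator
                (fun _ => (1 : ℝ)) z +
              (Icc R'' (R'' + 1)).indicator (fun _ => (1 : ℝ)) ⟪z.2, e⟫))) := by
  obtain ⟨D, hD, htime⟩ := exists_cone_time_cutoff
  obtain ⟨Cm, hCm, hmcut⟩ := exists_cone_levelset_cutoff (E := E)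
  obtain ⟨CΨ, hCΨ, hΨcut⟩ := exists_yn_cutoff (E := E)
  refine ⟨36 * Cm ^ 2 + 24 * (Cm * CΨ) + 9 * D ^ 2 + 3 * CΨ ^ 2 + 4 * Cm + 2 * CΨ + 1,
    by positivity, ?_⟩
  intro e he β ε η B θ R'' hβ hβ1 hε0 hε1 hηε hB hθ hθ1 hR''
  have hβ0 : 0 < β := by linarith
  have hη0 : 0 ≤ η := by rw [hηε]; exact Real.rpow_nonneg hε0.le _
  have hη1 : η ≤ 1 := by rw [hηε]; exact Real.rpow_le_one hε0.le hε1 (by linarith)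
  have hB0 : 0 < B := by linarith
  set δ : ℝ := B / (32 * (R'' + 1) ^ 2) with hδ
  have hδ0 : 0 < δ := by rw [hδ]; positivity
  obtain ⟨χt, hχt, hχtnn, hχtle, hχt0a, hχt0b, hχt1, hχt', hχt'0⟩ := htime θ δ hθ hδ0
  obtain ⟨m, hms, hmnn, hmle, hm0, hm1, hmd0, hmbd⟩ := hmcut e he β η B hβ hβ1 hη0 hη1 hB
  obtain ⟨Ψ, hΨs, hΨnn, hΨle, hΨ1, hΨ0a, hΨ0b, hdtΨ, hgΨ, hlapΨ, hΨd0⟩ := hΨcut e he R'' hR''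
  -- ### the sets
  set Ω : Set (ℝ × E) := halfDom e with hΩ
  have hΩo : IsOpen Ω := isOpen_halfDom e
  set L : ℝ × E → ℝ := fun z => kA 1 z.1 * conePhi0 β η e z.2 with hL
  -- ### the product `χ = (χ_t m) Ψ`
  set A : ℝ × E → ℝ := fun z => χt z.1 * m z with hA
  set χ : ℝ × E → ℝ := fun z => A z * Ψ z with hχ
  have hχts : ContDiff ℝ (⊤ : ℕ∞) fun z : ℝ × E => χt z.1 := hχt.comp contDiff_fst
  have hAs : ContDiffOn ℝ (⊤ : ℕ∞) A Ω := hχts.contDiffOn.mul hms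
  have hχΩ : ContDiffOn ℝ (⊤ : ℕ∞) χ Ω := hAs.mul hΨs.contDiffOn
  -- values
  have hA01 : ∀ z, 0 ≤ A z ∧ A z ≤ 1 := fun z =>
    ⟨mul_nonneg (hχtnn _) (hmnn _), (mul_le_mul (hχtle _) (hmle _) (hmnn _) zero_le_one).trans
      (by norm_num)⟩
  have hχ01 : ∀ z, 0 ≤ χ z ∧ χ z ≤ 1 := fun z =>
    ⟨mul_nonneg (hA01 z).1 (hΨnn _), (mul_le_mul (hA01 z).2 (hΨle _) (hΨnn _)
      zero_le_one).trans (by norm_num)⟩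
  -- ### where `χ ≠ 0`
  have hne : ∀ z, χ z ≠ 0 → 1 / 2 + θ < z.1 ∧ z.1 < 1 - δ ∧ ε * ‖z.2‖ < ⟪z.2, e⟫ ∧
      2 < ⟪z.2, e⟫ ∧ ⟪z.2, e⟫ < R'' + 1 ∧ B / 4 < conePhi0 β η e z.2 := by
    intro z hz
    simp only [hχ, hA, ne_eq, mul_eq_zero, not_or] at hz
    obtain ⟨⟨hz1, hz2⟩, hz3⟩ := hz
    have hs : 1 / 2 + θ < z.1 := by
      by_contra h; exact hz1 (hχt0a _ (le_of_not_gt h))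
    have hsδ : z.1 < 1 - δ := by
      by_contra h; exact hz1 (hχt0b _ (le_of_not_gt h))
    have hr12 : 1 / 2 < ⟪z.2, e⟫ := by
      by_contra h; exact hz3 (hΨ0a _ (le_of_not_gt h))
    have hrR : ⟪z.2, e⟫ < R'' + 1 := by
      by_contra h; exact hz3 (hΨ0b _ (le_of_not_gt h))
    have hkr : B / 4 < L z := by
      by_contra h; exact hz2 (hm0 _ (le_of_not_gt h))
    obtain ⟨hφ, hr2, -⟩ := facts_of_coneLevel_gt (R := R'' + 1) hβ hβ1 hη0 hB (by linarith)
      (by linarith) (by linarith) (by linarith) hrR.le hkr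
    have hcone : ε * ‖z.2‖ < ⟪z.2, e⟫ :=
      cone_of_conePhi0_pos hβ0 hε0 hηε (by linarith) (by linarith)
    exact ⟨hs, hsδ, hcone, hr2, hrR, hφ⟩
  -- support and smoothness
  have hce : Continuous fun y : E => ⟪y, e⟫ := continuous_id.inner continuous_const
  have hcφ : Continuous fun y : E => conePhi0 β η e y := continuous_conePhi0 hβ0 η e
  have hsupp0 : tsupport χ ⊆ Icc (1 / 2 + θ) (1 - δ) ×ˢ
      {y : E | 2 ≤ ⟪y, e⟫ ∧ ⟪y, e⟫ ≤ R'' + 1 ∧ B / 4 ≤ conePhi0 β η e y} := by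
    refine closure_minimal (fun z hz => ?_) ?_
    · obtain ⟨h1, h2, -, h4, h5, h6⟩ := hne z hz
      exact ⟨⟨h1.le, h2.le⟩, h4.le, h5.le, h6.le⟩
    · refine isClosed_Icc.prod ?_
      exact (isClosed_le continuous_const hce).inter ((isClosed_le hce continuous_const).inter
        (isClosed_le continuous_const hcφ))
  have hsupp : tsupport χ ⊆ Icc (1 / 2 + θ) (1 - δ) ×ˢ
      {y : E | ε * ‖y‖ < ⟪y, e⟫ ∧ 2 ≤ ⟪y, e⟫ ∧ ⟪y, e⟫ ≤ R'' + 1 ∧ B / 4 ≤ conePhi0 β η e y} := by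
    intro z hz
    obtain ⟨h1, h2, h3, h4⟩ := hsupp0 hz
    exact ⟨h1, cone_of_conePhi0_pos hβ0 hε0 hηε (by linarith) (by linarith), h2, h3, h4⟩
  have hsuppΩ : tsupport χ ⊆ Ω := fun z hz => by
    have h := hsupp0 hz
    exact ⟨by linarith [h.1.1], by show 0 < ⟪z.2, e⟫; linarith [h.2.1]⟩
  have hχ0 : ∀ z ∉ tsupport χ, χ z = 0 := fun z hz => image_eq_zero_of_notMem_tsupport hz
  have hχs : ContDiff ℝ (⊤ : ℕ∞) χ :=
    contDiff_of_contDiffOn_of_eq_zero hΩo (isClosed_tsupport χ) hsuppΩ hχΩ hχ0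
  have hχ2 : ContDiff ℝ 2 χ := hχs.of_le (by norm_cast)
  have hsuppK : tsupport χ ⊆ Icc (1 / 2 + θ) 1 ×ˢ closedBall (0 : E) ((R'' + 1) / ε) := by
    intro z hz
    obtain ⟨h1, h2, h3, h4, -⟩ := hsupp hz
    refine ⟨⟨h1.1, h1.2.trans (by linarith)⟩, ?_⟩
    rw [mem_closedBall, dist_zero_right, le_div_iff₀ hε0]
    nlinarith
  have hχc : HasCompactSupport χ :=
    HasCompactSupport.of_support_subset_isCompact (isCompact_Icc.prod (isCompact_closedBall _ _))
      ((subset_tsupport χ).trans hsuppK)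
  have hplateau : ∀ z : ℝ × E, 1 / 2 + 2 * θ ≤ z.1 → z.1 ≤ 1 → 1 ≤ ⟪z.2, e⟫ → ⟪z.2, e⟫ ≤ R'' →
      B / 2 ≤ L z → χ z = 1 := by
    intro z hs hs1 hr1 hrR hk
    have hz1 : 0 < z.1 := by linarith
    have hr0 : 0 < ⟪z.2, e⟫ := by linarith
    -- `s < 1`: at `s = 1`, `k₁ = 0`
    have hs1' : z.1 < 1 := by
      rcases lt_or_eq_of_le hs1 with h | h
      · exact h
      · exfalso
        have : kA 1 z.1 = 0 := by rw [h, kA_one_eq one_pos]; simp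
        have h2 : L z = 0 := by simp only [hL, this, zero_mul]
        linarith
    obtain ⟨-, -, hsR⟩ := facts_of_coneLevel_gt (R := R'') hβ hβ1 hη0 hB (by linarith) hs1' hr0
      (by linarith) hrR (by linarith : B / 4 < L z)
    have hs2 : z.1 ≤ 1 - 2 * δ := by
      rw [hδ]
      have h1 : B / (8 * R'' ^ 2) ≥ 2 * (B / (32 * (R'' + 1) ^ 2)) := by
        rw [ge_iff_le, show 2 * (B / (32 * (R'' + 1) ^ 2)) = B / (16 * (R'' + 1) ^ 2) by
          field_simp; ring]
        exact div_le_div_of_nonneg_left hB0.le (by positivity) (by nlinarith)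
      linarith
    simp only [hχ, hA]
    rw [hχt1 _ hs hs2, hm1 z hk, hΨ1 z hr1 hrR]
    norm_num
  suffices key : ∀ z : ℝ × E,
      ((dt χ z + lap χ z) ^ 2 ≤
        (36 * Cm ^ 2 + 24 * (Cm * CΨ) + 9 * D ^ 2 + 3 * CΨ ^ 2 + 4 * Cm + 2 * CΨ + 1) *
        (θ⁻¹ ^ 2 * (Icc (1 / 2 + θ) (1 / 2 + 2 * θ)).indicator (fun _ => (1 : ℝ)) z.1 +
          (1 + ‖z.2‖ ^ 2) ^ 2 *
            ({z : ℝ × E | 0 < z.1 ∧ 0 < ⟪z.2, e⟫ ∧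
                kA 1 z.1 * conePhi0 β η e z.2 ∈ Icc (B / 4) (B / 2)}.indicator
                (fun _ => (1 : ℝ)) z +
              (Icc R'' (R'' + 1)).indicator (fun _ => (1 : ℝ)) ⟪z.2, e⟫))) ∧
      (gradSq χ z ≤
        (36 * Cm ^ 2 + 24 * (Cm * CΨ) + 9 * D ^ 2 + 3 * CΨ ^ 2 + 4 * Cm + 2 * CΨ + 1) *
        ((1 + ‖z.2‖ ^ 2) ^ 2 *
            ({z : ℝ × E | 0 < z.1 ∧ 0 < ⟪z.2, e⟫ ∧
                kA 1 z.1 * conePhi0 β η e z.2 ∈ Icc (B / 4) (B / 2)}.indicator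
                (fun _ => (1 : ℝ)) z +
              (Icc R'' (R'' + 1)).indicator (fun _ => (1 : ℝ)) ⟪z.2, e⟫))) by
    exact ⟨χ, hχ2, hχc, hsupp, fun z => (hχ01 z).1, fun z => (hχ01 z).2, hplateau,
      fun z => (key z).1, fun z => (key z).2⟩
  -- ### the pointwise bounds
  intro z
  set iL : ℝ := (Icc (1 / 2 + θ) (1 / 2 + 2 * θ)).indicator (fun _ => (1 : ℝ)) z.1 with hiL
  set iM : ℝ := ({z : ℝ × E | 0 < z.1 ∧ 0 < ⟪z.2, e⟫ ∧
      kA 1 z.1 * conePhi0 β η e z.2 ∈ Icc (B / 4) (B / 2)}.indicator (fun _ => (1 : ℝ)) z) with hiM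
  set iN : ℝ := (Icc R'' (R'' + 1)).indicator (fun _ => (1 : ℝ)) ⟪z.2, e⟫ with hiN
  have hi01 : ∀ (T : Set ℝ) (x : ℝ), 0 ≤ T.indicator (fun _ => (1 : ℝ)) x ∧
      T.indicator (fun _ => (1 : ℝ)) x ≤ 1 := fun T x => by
    by_cases hx : x ∈ T <;> simp [hx]
  have hiL01 : 0 ≤ iL ∧ iL ≤ 1 := hi01 (Icc (1 / 2 + θ) (1 / 2 + 2 * θ)) z.1
  have hiN01 : 0 ≤ iN ∧ iN ≤ 1 := hi01 (Icc R'' (R'' + 1)) ⟪z.2, e⟫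
  have hiM01 : 0 ≤ iM ∧ iM ≤ 1 := by
    by_cases hx : z ∈ {z : ℝ × E | 0 < z.1 ∧ 0 < ⟪z.2, e⟫ ∧
      kA 1 z.1 * conePhi0 β η e z.2 ∈ Icc (B / 4) (B / 2)}
    · rw [hiM, Set.indicator_of_mem hx]; norm_num
    · rw [hiM, Set.indicator_of_notMem hx]; norm_num
  set Ctot : ℝ := 36 * Cm ^ 2 + 24 * (Cm * CΨ) + 9 * D ^ 2 + 3 * CΨ ^ 2 + 4 * Cm + 2 * CΨ + 1
    with hCtot
  have hCt0 : 0 ≤ Ctot := by rw [hCtot]; positivity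
  set q : ℝ := (1 + ‖z.2‖ ^ 2) ^ 2 with hq
  have hq0 : 0 ≤ q := by positivity
  have hq1 : 1 ≤ q := by rw [hq]; nlinarith [sq_nonneg ‖z.2‖]
  have hRHS0 : 0 ≤ Ctot * (θ⁻¹ ^ 2 * iL + q * (iM + iN)) := by
    have : 0 ≤ iM + iN := by linarith [hiM01.1, hiN01.1]
    have : 0 ≤ θ⁻¹ ^ 2 * iL := by have := hiL01.1; positivity
    positivity
  have hRHS2 : 0 ≤ Ctot * (q * (iM + iN)) := by
    have : 0 ≤ iM + iN := by linarith [hiM01.1, hiN01.1]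
    positivity
  by_cases hzs : z ∈ tsupport χ
  swap
  · -- off the support everything vanishes
    have hf : fderiv ℝ χ z = 0 := fderiv_of_notMem_tsupport (𝕜 := ℝ) hzs
    have h1 : dt χ z = 0 := by rw [dt_apply, hf]; rfl
    have h2 : gradSq χ z = 0 := by
      simp [gradSq, dx_apply, hf]
    have h3 : lap χ z = 0 :=
      image_eq_zero_of_notMem_tsupport fun h => hzs (tsupport_lap_subset χ h)
    rw [h1, h2, h3, add_zero, zero_pow two_ne_zero]
    exact ⟨hRHS0, hRHS2⟩
  -- on the support
  obtain ⟨⟨hs1, hs2⟩, hcone, hr2, hrR1, hφB⟩ := hsupp hzs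
  have hzΩ : z ∈ Ω := hsuppΩ hzs
  have hs1' : z.1 < 1 := by linarith
  have hshalf : 1 / 2 ≤ z.1 := by linarith
  set r : ℝ := ⟪z.2, e⟫ with hr
  have hr1 : 1 ≤ r := by linarith
  have hr0 : 0 < r := by linarith
  -- ## differentiability facts
  have hχt1 : ContDiff ℝ 1 χt := hχt.of_le (by norm_cast)
  have hχts2 : ContDiffOn ℝ 2 (fun z : ℝ × E => χt z.1) Ω := (hχts.of_le (by norm_cast)).contDiffOn
  have hm2 : ContDiffOn ℝ 2 m Ω := hms.of_le (by norm_cast)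
  have hA2 : ContDiffOn ℝ 2 A Ω := hAs.of_le (by norm_cast)
  have hΨ2 : ContDiffOn ℝ 2 Ψ Ω := (hΨs.of_le (by norm_cast)).contDiffOn
  have hχtd : DifferentiableAt ℝ (fun z : ℝ × E => χt z.1) z :=
    (hχts.differentiable (by simp)).differentiableAt
  have hmd : DifferentiableAt ℝ m z := (hms.differentiableOn (by simp)).differentiableAt (hΩo.mem_nhds hzΩ)
  have hAd : DifferentiableAt ℝ A z := (hAs.differentiableOn (by simp)).differentiableAt (hΩo.mem_nhds hzΩ)
  have hΨd : DifferentiableAt ℝ Ψ z := (hΨs.differentiable (by simp)).differentiableAt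
  -- ## the top layer: `s ≥ 1 - 2δ` forces `k₁φ₀ < B/4`, so everything vanishes at `z`
  by_cases htop : 1 - 2 * δ ≤ z.1
  · have hk0 : 0 ≤ kA 1 z.1 := kA_one_nonneg (by linarith) hs1'.le
    have hk2 : kA 1 z.1 ≤ 2 * (1 - z.1) := kA_one_le_two_mul hshalf hs1'.le
    have hφle : conePhi0 β η e z.2 ≤ (R'' + 1) ^ 2 :=
      (conePhi0_le_inner_sq hβ1 hη0 hr1).trans (pow_le_pow_left₀ hr0.le hrR1 2)
    have hφ0 : 0 ≤ conePhi0 β η e z.2 := by linarith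
    have hLlt : L z < B / 4 := by
      have h1 : L z ≤ 2 * (1 - z.1) * (R'' + 1) ^ 2 := mul_le_mul hk2 hφle hφ0 (by linarith)
      have h2 : 2 * (1 - z.1) ≤ 4 * δ := by linarith
      have h3 : 2 * (1 - z.1) * (R'' + 1) ^ 2 ≤ 4 * δ * (R'' + 1) ^ 2 :=
        mul_le_mul_of_nonneg_right h2 (by positivity)
      have h4 : 4 * δ * (R'' + 1) ^ 2 = B / 8 := by rw [hδ]; field_simp; ring
      linarith
    have hmz : m z = 0 := hm0 z hLlt.le
    obtain ⟨hdtm0, hgm0, hlapm0⟩ := hmd0 z hzΩ (fun h => by linarith [h.1])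
    have hdxm0 : ∀ i, dx (stdOrthonormalBasis ℝ E i) m z = 0 := by
      have h := (Finset.sum_eq_zero_iff_of_nonneg fun i _ => sq_nonneg _).1 hgm0
      intro i
      have := h i (Finset.mem_univ i)
      simpa using this
    have hAz : A z = 0 := by simp only [hA, hmz, mul_zero]
    have hdtA : dt A z = 0 := by
      rw [show A = fun y => (fun z : ℝ × E => χt z.1) y * m y from rfl, dt_mul hχtd hmd, hdtm0, hmz]
      ring
    have hdxA : ∀ i, dx (stdOrthonormalBasis ℝ E i) A z = 0 := by
      intro i
      rw [show A = fun y => (fun z : ℝ × E => χt z.1) y * m y from rfl, dx_mul hχtd hmd, hdxm0 i,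
        hmz]
      ring
    have hlapA : lap A z = 0 := by
      rw [show A = fun y => (fun z : ℝ × E => χt z.1) y * m y from rfl, lap_mul hΩo hzΩ hχts2 hm2,
        hlapm0, hmz, lap_timeProfile hχt1]
      simp only [mul_zero, zero_mul, zero_add, dx_timeProfile hχt1]
      simp
    have hdtχ : dt χ z = 0 := by
      rw [show χ = fun y => A y * Ψ y from rfl, dt_mul hAd hΨd, hdtA, hAz]; ring
    have hlapχ : lap χ z = 0 := by
      rw [show χ = fun y => A y * Ψ y from rfl, lap_mul hΩo hzΩ hA2 hΨ2, hlapA, hAz]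
      simp only [zero_mul, mul_zero, zero_add, hdxA]
      simp
    have hgχ : gradSq χ z = 0 := by
      have h1 := gradSq_mul_le (f := A) (h := Ψ) hAd hΨd
      have hgA : gradSq A z = 0 := by
        simp only [gradSq, hdxA]; simp
      rw [hAz, hgA] at h1
      have h2 : gradSq (fun y => A y * Ψ y) z ≤ 0 := by linarith
      exact le_antisymm h2 (gradSq_nonneg _ z)
    rw [hdtχ, hlapχ, hgχ, add_zero, zero_pow two_ne_zero]
    exact ⟨hRHS0, hRHS2⟩
  -- ## the main case `s < 1 - 2δ`
  push Not at htop
  -- `χ = A Ψ`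
  obtain ⟨hP, hg⟩ := prod_cutoff_bounds hΩo hzΩ hA2 hΨ2 (hA01 z).1 (hA01 z).2
    (by rw [abs_of_nonneg (hΨnn z)]; exact hΨle z)
  -- `A = χ_t m`
  obtain ⟨hPA, hgA⟩ := prod_cutoff_bounds (f := fun z : ℝ × E => χt z.1) (h := m) hΩo hzΩ
    hχts2 hm2 (hχtnn _) (hχtle _) (by rw [abs_of_nonneg (hmnn z)]; exact hmle z)
  rw [dt_timeProfile hχt1, lap_timeProfile hχt1, gradSq_timeProfile hχt1] at hPA
  rw [gradSq_timeProfile hχt1] at hgA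
  rw [hdtΨ] at hP
  -- ## the primitive bounds
  -- the time step
  have hb1 : deriv χt z.1 ^ 2 ≤ D ^ 2 * (θ⁻¹ ^ 2 * iL) := by
    by_cases hzL : z.1 ∈ Icc (1 / 2 + θ) (1 / 2 + 2 * θ)
    · have h1 : iL = 1 := by rw [hiL, Set.indicator_of_mem hzL]
      rw [h1, mul_one]
      have h2 : |deriv χt z.1| ≤ D / θ := hχt' _ htop
      have h3 : deriv χt z.1 ^ 2 ≤ (D / θ) ^ 2 := by
        rw [← sq_abs]; exact pow_le_pow_left₀ (abs_nonneg _) h2 2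
      rw [div_pow, div_eq_mul_inv, ← inv_pow] at h3
      exact h3
    · have h1 : deriv χt z.1 = 0 := hχt'0 _ htop (by
        simp only [mem_Icc, not_and_or, not_le] at hzL; exact hzL)
      rw [h1, zero_pow two_ne_zero]
      exact mul_nonneg (sq_nonneg _) (mul_nonneg (by positivity) hiL01.1)
  -- the level-set cut-off
  obtain ⟨hmdt, hmg, hmlap⟩ := hmbd z hshalf hs1'.le hr1
  have hb2 : (dt m z + lap m z) ^ 2 ≤ 4 * Cm ^ 2 * q * iM ∧ gradSq m z ≤ Cm * q * iM := by
    by_cases hzM : kA 1 z.1 * conePhi0 β η e z.2 ∈ Icc (B / 4) (B / 2)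
    · have h1 : iM = 1 := by
        have : z ∈ {z : ℝ × E | 0 < z.1 ∧ 0 < ⟪z.2, e⟫ ∧
            kA 1 z.1 * conePhi0 β η e z.2 ∈ Icc (B / 4) (B / 2)} := ⟨hzΩ.1, hzΩ.2, hzM⟩
        rw [hiM, Set.indicator_of_mem this]
      rw [h1, mul_one, mul_one]
      have hN1q : 1 + ‖z.2‖ ^ 2 ≤ q := by rw [hq]; nlinarith [sq_nonneg ‖z.2‖]
      constructor
      · have h2 : |dt m z + lap m z| ≤ 2 * Cm * (1 + ‖z.2‖ ^ 2) := by
          refine (abs_add_le _ _).trans ?_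
          linarith
        have h3 : (dt m z + lap m z) ^ 2 ≤ (2 * Cm * (1 + ‖z.2‖ ^ 2)) ^ 2 := by
          rw [← sq_abs]; exact pow_le_pow_left₀ (abs_nonneg _) h2 2
        calc (dt m z + lap m z) ^ 2 ≤ (2 * Cm * (1 + ‖z.2‖ ^ 2)) ^ 2 := h3
          _ = 4 * Cm ^ 2 * (1 + ‖z.2‖ ^ 2) ^ 2 := by ring
          _ = 4 * Cm ^ 2 * q := by rw [hq]
      · calc gradSq m z ≤ Cm * (1 + ‖z.2‖ ^ 2) := hmg
          _ ≤ Cm * q := by gcongr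
    · obtain ⟨h1, h2, h3⟩ := hmd0 z hzΩ hzM
      rw [h1, h2, h3, add_zero, zero_pow two_ne_zero]
      exact ⟨mul_nonneg (mul_nonneg (by positivity) hq0) hiM01.1,
        mul_nonneg (mul_nonneg hCm hq0) hiM01.1⟩
  -- the `⟪y, e⟫` cut-off (the transition at `[1/2, 1]` is excluded by `r ≥ 2`)
  have hb3 : lap Ψ z ^ 2 ≤ CΨ ^ 2 * iN ∧ gradSq Ψ z ≤ CΨ * iN := by
    by_cases hzN : ⟪z.2, e⟫ ∈ Icc R'' (R'' + 1)
    · have h1 : iN = 1 := by rw [hiN, Set.indicator_of_mem hzN]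
      rw [h1, mul_one, mul_one]
      exact ⟨by rw [← sq_abs]; exact pow_le_pow_left₀ (abs_nonneg _) (hlapΨ z) 2, hgΨ z⟩
    · have hno : ⟪z.2, e⟫ ∉ Icc (1 / 2 : ℝ) 1 ∪ Icc R'' (R'' + 1) := by
        simp only [mem_union, mem_Icc, not_or, not_and_or, not_le]
        exact ⟨Or.inr (by rw [← hr]; linarith), by
          simp only [mem_Icc, not_and_or, not_le] at hzN; exact hzN⟩
      obtain ⟨h1, h2⟩ := hΨd0 z hno
      rw [h1, h2, zero_pow two_ne_zero]
      exact ⟨mul_nonneg (sq_nonneg _) hiN01.1, mul_nonneg hCΨ hiN01.1⟩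
  -- ## assembling
  obtain ⟨hb2a, hb2b⟩ := hb2
  obtain ⟨hb3a, hb3b⟩ := hb3
  have hgm0 := gradSq_nonneg m z
  have hgΨ0 := gradSq_nonneg Ψ z
  have hgA0 := gradSq_nonneg A z
  have hP' : (dt χ z + lap χ z) ^ 2 ≤ 3 * (A z ^ 2 * (0 + lap Ψ z) ^ 2 +
      (dt A z + lap A z) ^ 2 + 4 * (gradSq A z * gradSq Ψ z)) := hP
  have hg' : gradSq χ z ≤ 2 * gradSq Ψ z + 2 * gradSq A z := hg
  have hPA1 : (dt A z + lap A z) ^ 2 ≤ 3 * (χt z.1 ^ 2 * (dt m z + lap m z) ^ 2 +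
      (deriv χt z.1 + 0) ^ 2 + 4 * (0 * gradSq m z)) := hPA
  have hgA1 : gradSq A z ≤ 2 * gradSq m z + 2 * 0 := hgA
  -- `(PA)² ≤ 3 ((Pm)² + χ_t'²)`
  have hPA' : (dt A z + lap A z) ^ 2 ≤ 3 * (4 * Cm ^ 2 * q * iM + D ^ 2 * (θ⁻¹ ^ 2 * iL)) := by
    have hχ2' : χt z.1 ^ 2 ≤ 1 := by
      have h0 := hχtnn z.1; have h1 := hχtle z.1; nlinarith only [h0, h1]
    have h1 : χt z.1 ^ 2 * (dt m z + lap m z) ^ 2 ≤ 1 * (4 * Cm ^ 2 * q * iM) :=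
      mul_le_mul hχ2' hb2a (sq_nonneg _) zero_le_one
    have h2 : (deriv χt z.1 + 0) ^ 2 = deriv χt z.1 ^ 2 := by rw [add_zero]
    have h3 : 4 * (0 * gradSq m z) = 0 := by ring
    rw [h2, h3] at hPA1
    linarith only [hPA1, h1, hb1]
  have hgA' : gradSq A z ≤ 2 * (Cm * q * iM) := by linarith only [hgA1, hb2b]
  -- the cross term `|∇A|² |∇Ψ|²`
  have hAB : gradSq A z * gradSq Ψ z ≤ 2 * (Cm * CΨ) * q * iM := by
    have h3 : 0 ≤ 2 * (Cm * q * iM) := mul_nonneg (by norm_num) (mul_nonneg (mul_nonneg hCm hq0) hiM01.1)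
    have h1 : gradSq A z * gradSq Ψ z ≤ (2 * (Cm * q * iM)) * (CΨ * iN) := mul_le_mul hgA' hb3b hgΨ0 h3
    have h2 : CΨ * iN ≤ CΨ := by
      have := mul_le_mul_of_nonneg_left hiN01.2 hCΨ; linarith only [this]
    have h4 := mul_le_mul_of_nonneg_left h2 h3
    have h5 : 2 * (Cm * q * iM) * CΨ = 2 * (Cm * CΨ) * q * iM := by ring
    linarith only [h1, h4, h5]
  -- `(Pχ)²` and `|∇χ|²`
  have hA2le : A z ^ 2 ≤ 1 := by
    have h0 := (hA01 z).1; have h1 := (hA01 z).2; nlinarith only [h0, h1]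
  have hPχ : (dt χ z + lap χ z) ^ 2 ≤ 3 * (CΨ ^ 2 * iN +
      3 * (4 * Cm ^ 2 * q * iM + D ^ 2 * (θ⁻¹ ^ 2 * iL)) + 4 * (2 * (Cm * CΨ) * q * iM)) := by
    have h1 : A z ^ 2 * (0 + lap Ψ z) ^ 2 ≤ 1 * (CΨ ^ 2 * iN) := by
      rw [zero_add]; exact mul_le_mul hA2le hb3a (sq_nonneg _) zero_le_one
    have h2 := mul_le_mul_of_nonneg_left hAB (by norm_num : (0 : ℝ) ≤ 4)
    linarith only [hP', h1, hPA', h2]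
  have hgχ : gradSq χ z ≤ 2 * (CΨ * iN) + 2 * (2 * (Cm * q * iM)) := by
    linarith only [hg', hb3b, hgA']
  -- ## comparison with the stated right-hand side
  have hiM0 := hiM01.1; have hiN0 := hiN01.1; have hiL0 := hiL01.1
  have hθi : 0 ≤ θ⁻¹ ^ 2 := by positivity
  have tN : iN ≤ q * iN := by
    have := mul_le_mul_of_nonneg_right hq1 hiN0; linarith only [this]
  have p1 : 0 ≤ q * iM := mul_nonneg hq0 hiM0
  have p4 : 0 ≤ θ⁻¹ ^ 2 * iL := mul_nonneg hθi hiL0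
  have hsum1 : (dt χ z + lap χ z) ^ 2 ≤
      9 * D ^ 2 * (θ⁻¹ ^ 2 * iL) + (36 * Cm ^ 2 + 24 * (Cm * CΨ)) * (q * iM) + 3 * CΨ ^ 2 * iN := by
    have e2 : 3 * (CΨ ^ 2 * iN + 3 * (4 * Cm ^ 2 * q * iM + D ^ 2 * (θ⁻¹ ^ 2 * iL)) +
        4 * (2 * (Cm * CΨ) * q * iM)) =
        9 * D ^ 2 * (θ⁻¹ ^ 2 * iL) + (36 * Cm ^ 2 + 24 * (Cm * CΨ)) * (q * iM) + 3 * CΨ ^ 2 * iN := by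
      ring
    linarith only [hPχ, e2]
  have hsum2 : gradSq χ z ≤ 4 * Cm * (q * iM) + 2 * CΨ * iN := by
    have e3 : 2 * (CΨ * iN) + 2 * (2 * (Cm * q * iM)) = 4 * Cm * (q * iM) + 2 * CΨ * iN := by ring
    linarith only [hgχ, e3]
  have hx1 : 0 ≤ Cm ^ 2 := sq_nonneg _
  have hx3 : 0 ≤ CΨ ^ 2 := sq_nonneg _
  have hx4 : 0 ≤ D ^ 2 := sq_nonneg _
  have hx5 : 0 ≤ Cm * CΨ := mul_nonneg hCm hCΨ
  have c1 : 9 * D ^ 2 ≤ Ctot := by rw [hCtot]; linarith only [hCm, hCΨ, hx1, hx3, hx4, hx5]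
  have c2 : 36 * Cm ^ 2 + 24 * (Cm * CΨ) ≤ Ctot := by
    rw [hCtot]; linarith only [hCm, hCΨ, hx1, hx3, hx4, hx5]
  have c3 : 3 * CΨ ^ 2 ≤ Ctot := by rw [hCtot]; linarith only [hCm, hCΨ, hx1, hx3, hx4, hx5]
  have c5 : 4 * Cm ≤ Ctot := by rw [hCtot]; linarith only [hCm, hCΨ, hx1, hx3, hx4, hx5]
  have c6 : 2 * CΨ ≤ Ctot := by rw [hCtot]; linarith only [hCm, hCΨ, hx1, hx3, hx4, hx5]
  have d1 := mul_le_mul_of_nonneg_right c1 p4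
  have d2 := mul_le_mul_of_nonneg_right c2 p1
  have d3 := mul_le_mul_of_nonneg_right c3 hiN0
  have d5 := mul_le_mul_of_nonneg_right c5 p1
  have d6 := mul_le_mul_of_nonneg_right c6 hiN0
  have d3' : Ctot * iN ≤ Ctot * (q * iN) := mul_le_mul_of_nonneg_left tN hCt0
  have hR : Ctot * (θ⁻¹ ^ 2 * iL + q * (iM + iN)) =
      Ctot * (θ⁻¹ ^ 2 * iL) + Ctot * (q * iM) + Ctot * (q * iN) := by ring
  have hR2 : Ctot * (q * (iM + iN)) = Ctot * (q * iM) + Ctot * (q * iN) := by ring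
  refine ⟨?_, ?_⟩
  · rw [hR]; linarith only [hsum1, d1, d2, d3, d3']
  · rw [hR2]; linarith only [hsum2, d5, d6, d3']

end ConeLevel

end Carleman

end Literature.Analysis.FluidPDE
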